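import Mathlib
import HarnessLib

/-!
# `HeteroclinicTriggerChain` — crux `TriggerChainFrontStep` (item stmt-NavierStokesRegularity-22785):
  NO RETURN past equal split — the carrier surplus of the forced arc stays non-positive once crossed

Supplies the hypothesis `D ≤ 0` of the exponential capture lemma (`…ForcedArcExp`). For the forced arc
`D′ = −2e·u² + f₁` (`|f₁| ≤ φ`) with the radius bounded below, `D² + 2u² ≥ ρ₋²`, at any return to the
level `D = 0` one has `2u² ≥ ρ₋²`, hence `D′ ≤ −eρ₋² + φ < 0` as soon as `φ < eρ₋²`: the level cannot be
crossed upwards (fencing with right derivatives on the window):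

  `D(s) ≤ 0 ⇒ D(t) ≤ 0` for `t ∈ [s,T]`   (`heteroclinicTriggerChain_forcedArcOn_nonpos_after`).

HONEST FRAMING: elementary real analysis on a segment; helper lemma for the crux (no stub credit); nothing
here is a statement about the Navier–Stokes equations; no summit, rung or crux is proved by this file.
-/

noncomputable section

set_option linter.dupNamespace false

open Real Set

namespace Summit.NavierStokesRegularity.NavierStokesRegularity.Theorems

/-- **No return past equal split.** On `[s,T]` (derivatives within the segment) let `D′ = −2e·u² + f₁`
with `e > 0`, `|f₁| ≤ φ`, radius `D² + 2u² ≥ ρ₋²` and `φ < e·ρ₋²`. If `D(s) ≤ 0` then `D(t) ≤ 0` for all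
`t ∈ [s,T]`. [folklore] -/
theorem heteroclinicTriggerChain_forcedArcOn_nonpos_after {e φ ρm s T : ℝ} {D u f₁ : ℝ → ℝ}
    (he : 0 < e)
    (hD : ∀ t ∈ Icc s T, HasDerivWithinAt D (-(2 * e * u t ^ 2) + f₁ t) (Icc s T) t)
    (hf₁ : ∀ t ∈ Icc s T, |f₁ t| ≤ φ)
    (hQ : ∀ t ∈ Icc s T, ρm ^ 2 ≤ D t ^ 2 + 2 * u t ^ 2) (hφ : φ < e * ρm ^ 2) (hDs : D s ≤ 0) :
    ∀ t ∈ Icc s T, D t ≤ 0 := by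
  have hDc : ContinuousOn D (Icc s T) := fun r hr => (hD r hr).continuousWithinAt
  have hD' : ∀ r ∈ Ico s T, HasDerivWithinAt D (-(2 * e * u r ^ 2) + f₁ r) (Ici r) r := fun r hr =>
    (hD r (Ico_subset_Icc_self hr)).mono_of_mem_nhdsWithin (Icc_mem_nhdsGE_of_mem hr)
  intro t ht
  refine image_le_of_deriv_right_lt_deriv_boundary (f := D) (B := fun _ => (0 : ℝ)) (B' := fun _ => 0)
    (a := s) (b := T) hDc hD' hDs (fun r => hasDerivAt_const r (0 : ℝ)) ?_ ht
  intro r hr hDr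
  have hr' := Ico_subset_Icc_self hr
  have hq := hQ r hr'
  rw [hDr] at hq
  have hu2 : ρm ^ 2 ≤ 2 * u r ^ 2 := by nlinarith
  have hf := (abs_le.1 (hf₁ r hr')).2
  show -(2 * e * u r ^ 2) + f₁ r < 0
  nlinarith

end Summit.NavierStokesRegularity.NavierStokesRegularity.Theorems

end
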